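import Literature.AlgebraicGeometry.Frobenioids.MonoidTransport
import Literature.AlgebraicGeometry.Frobenioids.EquivalencePreStepsFSMFF2008Assembly
import Literature.AnabelianGeometry.EtaleTheta.Discharge.Sec5Prop51Example39NonDilating
import Literature.AnabelianGeometry.EtaleTheta.Discharge.Sec5Prop51Thm44Pin

/-!
# [EtTh] §5 discharge: the cone node EtTh:Prop5.1 RE-CLOSED against the surviving forms of its two
# refuted-closure FACT binders (F-2363 `IsIntegral`, F-0615 `Example39_iv_cuspidallyPure`) — proof-only

S. Mochizuki, *The étale theta function and its Frobenioid-theoretic manifestations*, Publ. RIMS **45** (2009)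
[MochizukiEtTh2009], Prop. 5.1 p. 323 (PDF p. 97): "The Frobenioid `C` is a tempered Frobenioid of rationally
standard type over a slim base category `D`, whose monoid type is `ℤ`, and whose divisor monoid `Φ(−)` is perfect,
perf-factorial, non-dilating, and cuspidally pure. In particular, `C` and the self-equivalence `Ψ : C ⥲ C` satisfy all
of the hypotheses of Corollary 3.8, (i), (ii), (iii); Theorem 4.4" — stated in print as following "from Example 3.9,
(iv)"; Example 3.9 (iii) p. 310 (PDF p. 84): "`Φ_W^ell` is a perfect and [manifestly — cf. Remark 3.6.1]
group-saturated submonoid of the monoid `Φ_W` on `D_W`, which is, moreover, perf-factorial, non-dilating [cf.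
Proposition 3.4, (i) …], and cuspidally pure [cf. the well-known structure of the special fibers of the 'universal
combinatorial coverings']"; Example 3.9 (iv) p. 311 (PDF p. 85): "`Φ_α^ell := Φ_W^ell|_{D_α}` … it follows immediately
from the above discussion that … `Φ_α^ell` is … cuspidally pure"; Def. 3.6 (v) p. 304 (PDF p. 78): "`Φ` is *cuspidally
pure* if (a) for every non-cuspidal primary element `x ∈ Φ(A)` … there exists `y ∈ Φ^{bs-fld}(A)` such that `x ≤ y`;
(b) `Prime(Φ(A)) = Prime(Φ(A))^ncsp ∪ Prime(Φ(A))^csp` [disjoint union]"; [FrdI] §0 p. 11: "integral" (`M → M^gp`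
injective).  [cite: MochizukiEtTh2009, Prop 5.1 p.323 (PDF p.97)] [cite: MochizukiEtTh2009, Ex 3.9 p.84]
[cite: MochizukiEtTh2009, Def 3.6 p.78]

abc-iut cell, block C, K4 / C-R33 RE-CLOSE of the cone node **EtTh:Prop5.1** (abc-iut-L2-lead R788/R817 idle-seat menu
row (M6); abc-iut-c312-2 `CONE-K4-RECLOSE.tsv` v4: `landed(p407478)`, refuted-closure rows F-0615 / F-2363, class
RECLOSABLE), seat abc-iut-f-128 (gen 5).  PROOF-ONLY companion (0 definitions, no instance, no new `Prop`) of
abc-iut-L2-t3's `ThetaFrobenioid.lean` (`Example39Data`, `thetaFrobenioid`, `Example39_iv_cuspidallyPure`),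
abc-iut-L2-t9's `Discharge/Sec5Prop51Example39.lean` (`applicability_of_example39` — the node's closing theorem, whose
binders #12 `hΦ` and #20 `hcp` are the two K4 sites of `CONE-FACT-SURGERY.tsv`), abc-iut-w6-d062's
`Discharge/Sec5Prop51Example39NonDilating.lean` / `…Pins.lean` and abc-iut-L2-t9's `Discharge/Sec5Prop51Thm44Pin.lean`
(`applicability_of_example39_allPins`).  Nothing landed is edited or restated.

WHAT IS PROVED.
* `RealifiedDivisorMonoids.isIntegral_ΦR` — at the tree's [FrdI] vocabulary `treeMonoidVocab`, every `Φ₀^ℝ(Y)` of a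
  Def. 3.6 (i) realified datum IS a realification (`isRealification` = `IsRealificationVia`), hence integral
  (abc-iut-L1's `IsPerfFactorial.Rlf.isIntegral`, transported by `IsIntegral.of_mulEquiv`) — the companion of
  abc-iut-w6-d061's `isPerfect_ΦR`; `Frobenioids.IsIntegral.submonoid` — a submonoid of an integral (= cancellative,
  `isIntegral_iff_isCancelMul`) monoid is integral.
* **F-2363 at the node, DISCHARGED GENERICALLY**: `Example39Data.isIntegral_Φα` /
  `Example39Data.isIntegral_Φ_thetaFrobenioid` — for EVERY Example 3.9 datum `E` over `treeMonoidVocab`, every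
  `α` and every `h`, each `Φ_α^ell(X) ⊆ Φ_W^ℝ(X|_{D_W})` is integral; this is VERBATIM the binder
  `hΦ : ∀ X, IsIntegral ((E.thetaFrobenioid α h).Φ.carrier X)` of `applicability_of_example39` (site #12), now a
  theorem with no hypothesis.
* **F-0615 at the node, RE-KEYED to print's Example 3.9 (iii) clause** "`Φ_W^ell` is … cuspidally pure":
  `Example39Data.isCuspidallyPure_thetaFrobenioid_of_ΦellW` — `Φ_α^ell := Φ_W^ell|_{D_α}` inherits Def. 3.6 (v)(a)/(b)
  objectwise from `Φ_W^ell` (the conditions only read, at an object `X` of `D_α`, the submonoid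
  `Φ_α^ell(X) = Φ_W^ell(X|_{D_W})` of `Φ_W^ℝ(X|_{D_W})` together with the non-cuspidal / cuspidal / constant parts of the
  realified datum AT `X|_{D_W}`), exactly as abc-iut-L2-t3's `isPerfect_Φα` and abc-iut-w6-d062's `isNonDilating_Φα`
  inherit "perfect" and "non-dilating".  abc-iut-L2-t3's `Example39Data` records (iii)'s "perfect, group-saturated,
  perf-factorial, non-dilating" as fields but NOT its fifth printed property "cuspidally pure"; here that property is
  the explicit hypothesis triple (`hcpa`, `hcpb`, `hcpb'`), stated over `D_W` in Def. 3.6 (v)'s own words (no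
  definition is introduced) — a PRINTED HYPOTHESIS of the datum in place of the refuted-closure FACT head F-0615
  (whose universal closure fails only by choosing the cuspidal part of the realified datum inconsistently,
  abc-iut-f-144's `not_forall_example39_iv_cuspidallyPure`).
* **The node re-closed**: `Example39Data.applicability_of_example39_reclosed` — abc-iut-L2-t9's node closer with
  `hΦ` GONE (the §5 datum is compared with `thetaStub (isIntegral_Φ_thetaFrobenioid …)`) , "non-dilating" discharged
  (abc-iut-w6-d062) and `hcp` := the Example 3.9 (iii) clause; and `Example39Data.applicability_of_example39_allPins_reclosed`
  — abc-iut-L2-t9's all-pins form with, in addition, `h34` ([FrdI] Thm. 3.4 (ii), F-0711) consumed BY NAME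
  (`FrdI.Thm34ii_holds`): residual named inputs exactly {`hW`, `hWf` (Rmk. 3.7.2), `hZ` (`Λ = ℤ`), `hBmon`, `hrat`,
  `hKfix` (G-w5d250-1)} ∪ {Example 3.9 (iii) "`Φ_W^ell` cuspidally pure"}.

HONEST FRAMING: kernel re-keying over abc-iut-L2-t3's DATA structure `Example39Data` (a parameter record — nothing
here asserts that these data exist for an actual curve); the Example 3.9 (iii) clause is inhabited in the tree today
only at abc-iut-w5-d164's degenerate toy (`Toy.example39_iv_cuspidallyPure_toy`); [EtTh] is refereed; nothing here
bears on [IUTchIII] Cor. 3.12 — no side is taken; typed ≠ proved.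
-/

namespace Literature.AlgebraicGeometry.Frobenioids

universe w

/-- A submonoid of an integral monoid is integral ([FrdI] §0 p. 11: "integral" = `M → M^gp` injective =
cancellative, and cancellation is inherited by submonoids). [cite: MochizukiFrdI2008, §0 p.11] -/
theorem IsIntegral.submonoid {M : Type w} [CommMonoid M] (hM : IsIntegral M) (S : Submonoid M) :
    IsIntegral S := by
  rw [isIntegral_iff_isCancelMul] at hM ⊢
  haveI := hM
  haveI : IsLeftCancelMul S :=
    ⟨fun a b c habc => Subtype.ext (mul_left_cancel (congrArg Subtype.val habc : (a : M) * b = a * c))⟩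
  exact CommMagma.IsLeftCancelMul.toIsCancelMul _

end Literature.AlgebraicGeometry.Frobenioids

namespace Literature.AnabelianGeometry.EtaleTheta

open CategoryTheory Opposite Literature.AlgebraicGeometry.Frobenioids FrobenioidTheta TemperedFrobenioid

universe u₀ v₀ u v w

/-! ### 1. Def. 3.6 (i) at the tree's vocabulary: `Φ₀^ℝ(Y)` is integral (F-2363, generic) -/

namespace RealifiedDivisorMonoids

variable {D₀ : Type u₀} [Category.{v₀} D₀] (T : RealifiedDivisorMonoids (D₀ := D₀) treeMonoidVocab.{w})

/-- **`Φ₀^ℝ(Y)` is integral** for every realified datum over the tree's [FrdI] vocabulary (Def. 3.6 (i):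
`Φ₀^ℝ := Φ₀^rlf`; at `treeMonoidVocab` the field `isRealification` is an isomorphism onto abc-iut-L1's realification
`Φ₀(Y)^rlf`, which is integral — `IsPerfFactorial.Rlf.isIntegral`). [cite: MochizukiEtTh2009, Def 3.6 p.76] -/
theorem isIntegral_ΦR (Y : D₀ᵒᵖ) : IsIntegral (T.ΦR.obj Y) := by
  obtain ⟨h, e, -⟩ := T.isRealification Y
  exact (IsPerfFactorial.Rlf.isIntegral h).of_mulEquiv e.symm

/-- Every submonoid of `Φ₀^ℝ(Y)` is integral (tree vocabulary). [cite: MochizukiEtTh2009, Def 3.6 p.76] -/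
theorem isIntegral_submonoid_ΦR (Y : D₀ᵒᵖ) (S : Submonoid (T.ΦR.obj Y)) : IsIntegral S :=
  (T.isIntegral_ΦR Y).submonoid S

end RealifiedDivisorMonoids

/-- The divisor monoid `Φ(A) ⊆ Φ^{ℝ-log}(A) = Φ₀^ℝ(Y_A)` of ANY tempered Frobenioid over the tree's [FrdI] vocabulary
is integral objectwise (Def. 3.6 (ii): `Φ` is a submonoid of a realification). [cite: MochizukiEtTh2009, Def 3.6 p.77] -/
theorem TemperedFrobenioid.isIntegral_Φ_treeMonoidVocab {D₀ : Type u₀} [Category.{v₀} D₀]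
    {T : RealifiedDivisorMonoids (D₀ := D₀) treeMonoidVocab.{w}} {D : Type u} [Category.{v} D]
    {VD : FrdICatStub.{u, v, w} D} (C : TemperedFrobenioid T D VD) (A : Dᵒᵖ) :
    IsIntegral (C.Φ.carrier A) :=
  T.isIntegral_submonoid_ΦR _ _

namespace Example39Data

/-! ### 2. Example 3.9 (iv): `Φ_α^ell(X)` is integral — the binder `hΦ` of the node closer, hypothesis-free -/

section TreeMonoidVocabIntegral

variable {DW : Type u} [Category.{v} DW] {TW : RealifiedDivisorMonoids (D₀ := DW) treeMonoidVocab.{w}}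
  (E : Example39Data treeMonoidVocab.{w} DW TW) {A B : DW} (α : A ⟶ B)

/-- **F-2363 at EtTh:Prop5.1, generic**: `Φ_α^ell(X) = Φ_W^ell(X|_{D_W}) ⊆ Φ_W^ℝ(X|_{D_W})` is integral for every
object `X` of `D_α` (tree vocabulary; no hypothesis). [cite: MochizukiEtTh2009, Ex 3.9 p.85] -/
theorem isIntegral_Φα (X : (Dα α)ᵒᵖ) : IsIntegral ((E.Φα α).carrier X) :=
  TW.isIntegral_submonoid_ΦR _ _

/-- The same in the shape of the binder `hΦ : ∀ X, IsIntegral ((E.thetaFrobenioid α h).Φ.carrier X)` of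
abc-iut-L2-t9's `applicability_of_example39` (`CONE-FACT-SURGERY.tsv` site #12, FACT row F-2363): a THEOREM for
every Example 3.9 datum over `treeMonoidVocab`. [cite: MochizukiEtTh2009, Prop 5.1 p.323 (PDF p.97)] -/
theorem isIntegral_Φ_thetaFrobenioid {VD : FrdICatStub.{max u v, v, w} (Dα α)} (h : E.FrobenioidHyp α VD)
    (X : (Dα α)ᵒᵖ) : IsIntegral ((E.thetaFrobenioid α h).Φ.carrier X) :=
  E.isIntegral_Φα α X

end TreeMonoidVocabIntegral

/-! ### 3. Example 3.9 (iv): `Φ_α^ell` inherits "cuspidally pure" from `Φ_W^ell` (Example 3.9 (iii)), any vocabulary -/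

section AnyVocab

variable {V : FrdIMonoidStub.{w}} {DW : Type u} [Category.{v} DW] {TW : RealifiedDivisorMonoids (D₀ := DW) V}
  (E : Example39Data V DW TW) {A B : DW} (α : A ⟶ B)

/-- **Example 3.9 (iv): `Φ_α^ell := Φ_W^ell|_{D_α}` is cuspidally pure as soon as `Φ_W^ell` is** — i.e. abc-iut-L2-t3's
named fact `Example39_iv_cuspidallyPure` (F-0615) at `(E, α, h)` follows from print's Example 3.9 (iii) clause
"`Φ_W^ell` is … cuspidally pure", stated objectwise on `D_W` in the words of Def. 3.6 (v): (a) `hcpa` — every primary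
`x ∈ Φ_W^ell(Y)` arising from a non-cuspidal log-divisor is bounded (`x ≤ y`, i.e. `x ∣ y`) by some `y ∈ Φ_W^ell(Y)` lying in
`ℝ·Φ₀^cnst(Y)` (base-field-theoretic); (b) `hcpb` / `hcpb'` — every prime of `Φ_W^ell(Y)` is non-cuspidal or cuspidal,
and not both.  For an object `X` of `D_α` the conditions for `Φ_α^ell(X)` ARE these conditions at `Y := X|_{D_W}`
("it follows immediately from the above discussion", p. 311). [cite: MochizukiEtTh2009, Ex 3.9 p.85] -/
theorem isCuspidallyPure_thetaFrobenioid_of_ΦellW {VD : FrdICatStub.{max u v, v, w} (Dα α)}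
    (h : E.FrobenioidHyp α VD)
    (hcpa : ∀ (Y : DWᵒᵖ) (x : E.ΦellW.carrier Y), IsPrimary x → (x : TW.ΦR.obj Y) ∈ TW.ncspR Y →
      ∃ y : E.ΦellW.carrier Y, Algebra.GrothendieckGroup.of (y : TW.ΦR.obj Y) ∈ TW.cnstR Y ∧ x ∣ y)
    (hcpb : ∀ (Y : DWᵒᵖ) (𝔭 : Primes (E.ΦellW.carrier Y)),
      (∀ x ∈ 𝔭.carrier, (x : TW.ΦR.obj Y) ∈ TW.ncspR Y) ∨ (∀ x ∈ 𝔭.carrier, (x : TW.ΦR.obj Y) ∈ TW.cspR Y))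
    (hcpb' : ∀ (Y : DWᵒᵖ) (𝔭 : Primes (E.ΦellW.carrier Y)),
      ¬ ((∀ x ∈ 𝔭.carrier, (x : TW.ΦR.obj Y) ∈ TW.ncspR Y) ∧ (∀ x ∈ 𝔭.carrier, (x : TW.ΦR.obj Y) ∈ TW.cspR Y))) :
    E.Example39_iv_cuspidallyPure α h where
  exists_bsFld_dvd X x hx hnc := by
    obtain ⟨y, hy, hxy⟩ := hcpa ((toDW α).op.obj X) x hx hnc
    exact ⟨y, Submonoid.mem_inf.mpr ⟨y.2, Submonoid.mem_comap.mpr hy⟩, hxy⟩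
  ncsp_or_csp X 𝔭 := hcpb ((toDW α).op.obj X) 𝔭
  not_ncsp_and_csp X 𝔭 := hcpb' ((toDW α).op.obj X) 𝔭

/-- Conversely (bookkeeping, so that the re-keying loses nothing at `α`): cuspidal purity of `Φ_α^ell` IS the triple of
Def. 3.6 (v) conditions for `Φ_W^ell` at the objects `X|_{D_W}`, `X ∈ Ob(D_α)`. [cite: MochizukiEtTh2009, Ex 3.9 p.85] -/
theorem example39_iv_cuspidallyPure_iff {VD : FrdICatStub.{max u v, v, w} (Dα α)} (h : E.FrobenioidHyp α VD) :
    E.Example39_iv_cuspidallyPure α h ↔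
      (∀ (X : (Dα α)ᵒᵖ) (x : E.ΦellW.carrier ((toDW α).op.obj X)), IsPrimary x →
          (x : TW.ΦR.obj ((toDW α).op.obj X)) ∈ TW.ncspR ((toDW α).op.obj X) →
          ∃ y : E.ΦellW.carrier ((toDW α).op.obj X),
            Algebra.GrothendieckGroup.of (y : TW.ΦR.obj ((toDW α).op.obj X)) ∈ TW.cnstR ((toDW α).op.obj X) ∧ x ∣ y) ∧
      (∀ (X : (Dα α)ᵒᵖ) (𝔭 : Primes (E.ΦellW.carrier ((toDW α).op.obj X))),
          (∀ x ∈ 𝔭.carrier, (x : TW.ΦR.obj ((toDW α).op.obj X)) ∈ TW.ncspR ((toDW α).op.obj X)) ∨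
          (∀ x ∈ 𝔭.carrier, (x : TW.ΦR.obj ((toDW α).op.obj X)) ∈ TW.cspR ((toDW α).op.obj X))) ∧
      (∀ (X : (Dα α)ᵒᵖ) (𝔭 : Primes (E.ΦellW.carrier ((toDW α).op.obj X))),
          ¬ ((∀ x ∈ 𝔭.carrier, (x : TW.ΦR.obj ((toDW α).op.obj X)) ∈ TW.ncspR ((toDW α).op.obj X)) ∧
             (∀ x ∈ 𝔭.carrier, (x : TW.ΦR.obj ((toDW α).op.obj X)) ∈ TW.cspR ((toDW α).op.obj X)))) := by
  constructor
  · intro hp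
    refine ⟨fun X x hx hnc => ?_, fun X 𝔭 => hp.ncsp_or_csp X 𝔭, fun X 𝔭 => hp.not_ncsp_and_csp X 𝔭⟩
    obtain ⟨y, hy, hxy⟩ := hp.exists_bsFld_dvd X x hx hnc
    exact ⟨y, (Submonoid.mem_inf.mp hy).2, hxy⟩
  · rintro ⟨ha, hb, hb'⟩
    exact
      { exists_bsFld_dvd := fun X x hx hnc => by
          obtain ⟨y, hy, hxy⟩ := ha X x hx hnc
          exact ⟨y, Submonoid.mem_inf.mpr ⟨y.2, Submonoid.mem_comap.mpr hy⟩, hxy⟩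
        ncsp_or_csp := hb
        not_ncsp_and_csp := hb' }

end AnyVocab

/-! ### 4. The node EtTh:Prop5.1 re-closed -/

section Reclosed

variable {DW : Type u} [Category.{v} DW] {TW : RealifiedDivisorMonoids (D₀ := DW) treeMonoidVocab.{w}}
  (E : Example39Data treeMonoidVocab.{w} DW TW) {A B : DW} (α : A ⟶ B)

/-- **EtTh:Prop5.1 RE-CLOSED (K4 / C-R33)** — abc-iut-L2-t9's node closer `applicability_of_example39` for §5 data over
the Example 3.9 (iv) Frobenioid `C₀ := E.thetaFrobenioid α h` at the tree's monoid vocabulary, with BOTH refuted-closure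
FACT binders replaced by their surviving forms: `hΦ` (F-2363) is GONE — the §5 datum is compared with
`C₀.thetaStub (isIntegral_Φ_thetaFrobenioid …) IsBFT`, a closed term —, and `hcp` (F-0615) is SUPPLIED from print's
Example 3.9 (iii) clause "`Φ_W^ell` is cuspidally pure" (`hcpa`, `hcpb`, `hcpb'`, Def. 3.6 (v) objectwise on `D_W`);
"non-dilating" is abc-iut-w6-d062's theorem.  Residual named inputs: the three vocabulary parameters (`hrs`, `h38`,
`h44`), `D_W` slim (`hW`, Rmk. 3.7.2), `Λ = ℤ` (`hZ`), and Example 3.9 (iii)'s cuspidal purity of `Φ_W^ell`.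
[cite: MochizukiEtTh2009, Prop 5.1 p.323 (PDF p.97)] -/
theorem applicability_of_example39_reclosed {VD : FrdICatStub.{max u v, v, w} (Dα α)}
    (h : E.FrobenioidHyp α VD)
    (𝔉 : ThetaFrobenioid.{w} (E.thetaFrobenioid α h).category (Dα α))
    (P : (E.thetaFrobenioid α h).VocabParams)
    {IsBFT : MorphismProperty (E.thetaFrobenioid α h).category}
    (h𝔉 : 𝔉.toTemperedFrobenioidStub =
      (E.thetaFrobenioid α h).thetaStub (E.isIntegral_Φ_thetaFrobenioid α h) IsBFT)
    (Ψ : (E.thetaFrobenioid α h).category ≌ (E.thetaFrobenioid α h).category)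
    (hrs : P.IsRationallyStandard) (hW : IsSlim DW) (hZ : TW.Λ = MonoidType.Z)
    (hcpa : ∀ (Y : DWᵒᵖ) (x : E.ΦellW.carrier Y), IsPrimary x → (x : TW.ΦR.obj Y) ∈ TW.ncspR Y →
      ∃ y : E.ΦellW.carrier Y, Algebra.GrothendieckGroup.of (y : TW.ΦR.obj Y) ∈ TW.cnstR Y ∧ x ∣ y)
    (hcpb : ∀ (Y : DWᵒᵖ) (𝔭 : Primes (E.ΦellW.carrier Y)),
      (∀ x ∈ 𝔭.carrier, (x : TW.ΦR.obj Y) ∈ TW.ncspR Y) ∨ (∀ x ∈ 𝔭.carrier, (x : TW.ΦR.obj Y) ∈ TW.cspR Y))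
    (hcpb' : ∀ (Y : DWᵒᵖ) (𝔭 : Primes (E.ΦellW.carrier Y)),
      ¬ ((∀ x ∈ 𝔭.carrier, (x : TW.ΦR.obj Y) ∈ TW.ncspR Y) ∧ (∀ x ∈ 𝔭.carrier, (x : TW.ΦR.obj Y) ∈ TW.cspR Y)))
    (h38 : P.HypothesesCor38 Ψ) (h44 : P.HypothesesThm44 Ψ) :
    FrobenioidThetaBiKummer.ApplicabilityOfGeneralTheory 𝔉 (thetaVocab 𝔉 P) Ψ :=
  E.applicability_of_example39_treeMonoidVocab α h 𝔉 P h𝔉 Ψ hrs hW hZ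
    (E.isCuspidallyPure_thetaFrobenioid_of_ΦellW α h hcpa hcpb hcpb') h38 h44

variable {IsRational IsStrictlyRational : ((Dα α)ᵒᵖ ⥤ CommMonCat.{w}) → Prop}

/-- **EtTh:Prop5.1 RE-CLOSED, all-pins form** — abc-iut-L2-t9's `applicability_of_example39_allPins` (Prop. 5.1 for
§5 data over the Example 3.9 (iv) Frobenioid with the three vocabulary pins "rationally standard type", "hypotheses of
Cor. 3.8", "hypotheses of Thm. 4.4" REAL and DERIVED) with: `hΦ` (F-2363) GONE (closed term
`isIntegral_Φ_thetaFrobenioid`), `hcp` (F-0615) := print's Example 3.9 (iii) clause (`hcpa`, `hcpb`, `hcpb'`), and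
`h34` ([FrdI] Thm. 3.4 (ii), F-0711) consumed BY NAME (`FrdI.Thm34ii_holds`).  Residual named inputs exactly
{`hW`, `hWf` (Rmk. 3.7.2: `D_W` slim, of FSM-type), `hZ` (`Λ = ℤ`), `hBmon` ([FrdI] Thm. 5.2 preamble), `hrat`
(Def. 3.6 (ii) "`Φ` rational"), `hKfix` (G-w5d250-1)} ∪ {Example 3.9 (iii) "`Φ_W^ell` cuspidally pure"}.
[cite: MochizukiEtTh2009, Prop 5.1 p.323 (PDF p.97)] -/
theorem applicability_of_example39_allPins_reclosed
    (h : E.FrobenioidHyp α (treeCatVocab (Dα α) IsRational IsStrictlyRational))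
    (hBmon : IsMonoidOn (E.thetaFrobenioid α h).ratFnFunctor)
    (hW : IsSlim DW) (hWf : IsOfFSMType DW) (hZ : TW.Λ = MonoidType.Z)
    (hcpa : ∀ (Y : DWᵒᵖ) (x : E.ΦellW.carrier Y), IsPrimary x → (x : TW.ΦR.obj Y) ∈ TW.ncspR Y →
      ∃ y : E.ΦellW.carrier Y, Algebra.GrothendieckGroup.of (y : TW.ΦR.obj Y) ∈ TW.cnstR Y ∧ x ∣ y)
    (hcpb : ∀ (Y : DWᵒᵖ) (𝔭 : Primes (E.ΦellW.carrier Y)),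
      (∀ x ∈ 𝔭.carrier, (x : TW.ΦR.obj Y) ∈ TW.ncspR Y) ∨ (∀ x ∈ 𝔭.carrier, (x : TW.ΦR.obj Y) ∈ TW.cspR Y))
    (hcpb' : ∀ (Y : DWᵒᵖ) (𝔭 : Primes (E.ΦellW.carrier Y)),
      ¬ ((∀ x ∈ 𝔭.carrier, (x : TW.ΦR.obj Y) ∈ TW.ncspR Y) ∧ (∀ x ∈ 𝔭.carrier, (x : TW.ΦR.obj Y) ∈ TW.cspR Y)))
    (hrat : ∀ Y : (E.thetaFrobenioid α h).category,
      PreFrobenioidData.IsRational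
        (PreFrobenioid.biratData ((E.thetaFrobenioid α h).isFrobenioid_treeCatVocab_of_isMonoidOn hBmon)
          (PreFrobenioid.hasBiratSquares_of_isFrobenioid
            ((E.thetaFrobenioid α h).isFrobenioid_treeCatVocab_of_isMonoidOn hBmon)))
        (S := PreFrobenioidData.ofFunctor (E.thetaFrobenioid α h).divisorMonoid (E.thetaFrobenioid α h).toElem)
        (fun a 𝔭 => PrimarySupp a 𝔭) Y)
    (hKfix : ∀ (Y : Dα α) (f : Y ≅ Y) (b : TW.BΛ.obj ((E.thetaFrobenioid α h).baseOp (op Y)))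
      (ξ : Algebra.GrothendieckGroup ((E.thetaFrobenioid α h).Φ.carrier (op Y))),
      b ∈ TW.FΛ ((E.thetaFrobenioid α h).baseOp (op Y)) → (b, ξ) ∈ (E.thetaFrobenioid α h).ratFn (op Y) →
        pullGp (E.thetaFrobenioid α h).divisorMonoid f.hom ξ = ξ)
    (𝔉 : ThetaFrobenioid.{w} (E.thetaFrobenioid α h).category (Dα α))
    {IsBFT : MorphismProperty (E.thetaFrobenioid α h).category}
    (h𝔉 : 𝔉.toTemperedFrobenioidStub =
      (E.thetaFrobenioid α h).thetaStub (E.isIntegral_Φ_thetaFrobenioid α h) IsBFT)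
    (Ψ : (E.thetaFrobenioid α h).category ≌ (E.thetaFrobenioid α h).category) :
    FrobenioidThetaBiKummer.ApplicabilityOfGeneralTheory 𝔉
      (thetaVocab 𝔉
        { IsRationallyStandard :=
            (PreFrobenioidData.ofFunctor (E.thetaFrobenioid α h).divisorMonoid
                (E.thetaFrobenioid α h).toElem).IsOfRationallyStandardType
              (PreFrobenioid.rsParams ((E.thetaFrobenioid α h).isFrobenioid_treeCatVocab_of_isMonoidOn hBmon)
                fun a 𝔭 => PrimarySupp a 𝔭)
          HypothesesCor38 := fun Ψ' => ∃ hh : Cor38Hyp (E.thetaFrobenioid α h) (E.thetaFrobenioid α h), hh.Ψ = Ψ'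
          HypothesesThm44 := fun Ψ' =>
            (∀ (Y : (Dα α)ᵒᵖ) (f : Y ⟶ Y), treeMonoidVocab.{w}.IsNonDilating
                ((E.thetaFrobenioid α h).Φ.carrier Y) ((E.thetaFrobenioid α h).Φ.pull f)) ∧
              ∃ Ψbs : Dα α ≌ Dα α, Nonempty ((E.thetaFrobenioid α h).baseFunctorOfCategory ⋙ Ψbs.functor ≅
                Ψ'.functor ⋙ (E.thetaFrobenioid α h).baseFunctorOfCategory) })
      Ψ :=
  E.applicability_of_example39_allPins α h FrdI.Thm34ii_holds hBmon hW hWf hZ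
    (E.isCuspidallyPure_thetaFrobenioid_of_ΦellW α h hcpa hcpb hcpb') hrat hKfix 𝔉 h𝔉 Ψ

end Reclosed

end Example39Data

end Literature.AnabelianGeometry.EtaleTheta
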